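import Summits.Ventures.PercRepro.SixFourT4Bridge
import Summits.Ventures.PercRepro.SixFourPLNorm
import Summits.Ventures.PercRepro.SixFourT4Identity

/-!
# PercRepro — C-025 at `(6,4)`: «plane + two points» solids at `t = 4`, `g ≤ 9`, part A (p2, gen 8 — Theorem 21.6, the
(β) `k = 2` half of the `g ≤ 9` clause of `SixFourResidue`): the profile inequality and the coloop bounds

mine-2's `MINE2-RLS.md` §21.6 (Theorem 21.6 at `t = 4`, Lemma 21.6a): for `G = τ ⊔ {a, a′}` with `τ = P₀ ∩ G` the trace
of a plane, the rank-`4` subsets of `G` are `B″ ∪ {a}`, `B″ ∪ {a′}`, `B″ ∪ {a, a′}` with `B″ ∈ R₃(τ)` (plus the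
`B″ ∪ {a, a′}` with `B″` collinear, never in `U₄`).  With `k(B″) := #{y ∈ B″ : r(B″ ∖ y) ≤ 2}` (`3` for a triple,
`≤ 1` otherwise) the coloop counts give `w_∞(B″ ∪ x) ≥ 1/(2 + k)`, `w_∞(B″ ∪ {a, a′}) ≥ 1/(1 + k)`, and `B″ ∪ x ∈ U₄`
iff `r(τ ∖ B″) = 3`, so
  `J₄ ≥ Σ_{B″ ∈ R₃(τ)} [4/(2 + k) + 2/(1 + k)] − (12/5)·#{B″ ∈ R₃(τ) : r(τ ∖ B″) = 3}`     (`J_four_ge_shares`),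
and `#{r(τ ∖ B″) = 3} ≤ #{B″ ∈ R₃(τ) : |B″| ≤ p − 3}`.  The right side is a LINE-PROFILE inequality
(`39·T + 120·D₃ − 50·LP ≥ 72·#{|B″| ≤ p − 3}` with `T` the independent triples, `D₃` the rank-`3` sets with `≥ 4`
points, `LP` the «line + point» sets), decided over the admissible profiles with `p ≤ 7` whose `≥ 3`-lines pairwise
share `≤ 1` point (`profCheck`, 44 profiles, minimum slack `39`); the bridges to the plane are p3's
`D3_eq_D3Prof` / `r34_eq_r34Prof` and two new counts (`card_triples_eq`, `card_lp_le`).  Main result: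
`J_four_nonneg_of_plane_add_two : (P₀ ∩ G).card + 2 = G.card → G.card ≤ 9 → 0 ≤ J M G 4`.
-/

namespace PercRepro.SixFour

/-! ## The profile side -/

/-- `T = C(p,3) − Σ_m inc_m·C(m,3)`: the independent triples of a rank-`3` plane, in `ℤ`. -/
def TProf (p i3 i4 i5 i6 : ℕ) : ℤ := (p.choose 3 : ℤ) - (i3 * 1 + i4 * 4 + i5 * 10 + i6 * 20)

/-- `LP = Σ_m inc_m·ε(m)·(p − m)`: the «line + point» sets (`ε(3) = 1, ε(4) = 5, ε(5) = 16, ε(6) = 42`). -/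
def LPProf (p i3 i4 i5 i6 : ℕ) : ℤ :=
  (i3 : ℤ) * 1 * ((p - 3 : ℕ) : ℤ) + (i4 : ℤ) * 5 * ((p - 4 : ℕ) : ℤ) + (i5 : ℤ) * 16 * ((p - 5 : ℕ) : ℤ) +
    (i6 : ℤ) * 42 * ((p - 6 : ℕ) : ℤ)

/-- `#{B″ ∈ R₃(τ) : |B″| ≤ p − 3}` for `p ≤ 7`: the triples when `p ≥ 6` and the rank-`3` `4`-sets when `p ≥ 7`. -/
def SmallProf (p i3 i4 i5 i6 : ℕ) : ℤ :=
  (if 6 ≤ p then TProf p i3 i4 i5 i6 else 0) + (if 7 ≤ p then (r34Prof p i4 i5 i6 : ℤ) else 0)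

/-- The profile inequality of Theorem 21.6 at `t = 4` (scaled by `30`):
`39·T + 120·D₃ − 50·LP ≥ 72·#{|B″| ≤ p − 3}`. -/
def ProfIneq (p i3 i4 i5 i6 : ℕ) : Prop :=
  72 * SmallProf p i3 i4 i5 i6 ≤ 39 * TProf p i3 i4 i5 i6 + 120 * (D3Prof p i4 i5 i6 : ℤ) - 50 * LPProf p i3 i4 i5 i6

/-- `ProfIneq` is decidable. -/
instance (p i3 i4 i5 i6 : ℕ) : Decidable (ProfIneq p i3 i4 i5 i6) := by unfold ProfIneq; infer_instance

/-- Two distinct lines with `≥ 3` points share at most one point: `inc_m ≥ 2 → 2m − 1 ≤ p`, and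
`inc_m, inc_m′ ≥ 1 → m + m′ − 1 ≤ p`. -/
def PairOK (p i3 i4 i5 i6 : ℕ) : Prop :=
  (2 ≤ i3 → 5 ≤ p) ∧ (2 ≤ i4 → 7 ≤ p) ∧ (2 ≤ i5 → 9 ≤ p) ∧ (2 ≤ i6 → 11 ≤ p) ∧
  (1 ≤ i3 → 1 ≤ i4 → 6 ≤ p) ∧ (1 ≤ i3 → 1 ≤ i5 → 7 ≤ p) ∧ (1 ≤ i3 → 1 ≤ i6 → 8 ≤ p) ∧
  (1 ≤ i4 → 1 ≤ i5 → 8 ≤ p) ∧ (1 ≤ i4 → 1 ≤ i6 → 9 ≤ p) ∧ (1 ≤ i5 → 1 ≤ i6 → 10 ≤ p)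

/-- `PairOK` is decidable. -/
instance (p i3 i4 i5 i6 : ℕ) : Decidable (PairOK p i3 i4 i5 i6) := by unfold PairOK; infer_instance

/-- The finite check: every admissible, pairwise-OK profile with `p ≤ 7` satisfies the inequality. -/
def profCheck : Prop := ∀ p < 8, ∀ i3 < 8, ∀ i4 < 4, ∀ i5 < 3, ∀ i6 < 2,
  (!decide (ProfileOK p (p.choose 2 - (3 * i3 + 6 * i4 + 10 * i5 + 15 * i6)) i3 i4 i5 i6 ∧ PairOK p i3 i4 i5 i6) ||
    decide (ProfIneq p i3 i4 i5 i6)) = true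

/-- The finite check holds (`44` profiles, minimum slack `39`). -/
theorem profCheck_holds : profCheck := by
  unfold profCheck
  decide

/-- **The profile inequality** for every admissible, pairwise-OK profile with `p ≤ 7`. -/
theorem profIneq_of_profileOK {p i2 i3 i4 i5 i6 : ℕ} (hp : p ≤ 7) (h3 : i3 < 8) (h4 : i4 < 4) (h5 : i5 < 3)
    (h6 : i6 < 2) (hok : ProfileOK p i2 i3 i4 i5 i6) (hpair : PairOK p i3 i4 i5 i6) : ProfIneq p i3 i4 i5 i6 := by
  have hi2 : i2 = p.choose 2 - (3 * i3 + 6 * i4 + 10 * i5 + 15 * i6) := by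
    have := hok.1
    omega
  subst hi2
  have h := profCheck_holds p (by omega) i3 h3 i4 h4 i5 h5 i6 h6
  rw [Bool.or_eq_true, Bool.not_eq_true', decide_eq_false_iff_not, decide_eq_true_eq] at h
  exact h.resolve_left (not_not.2 ⟨hok, hpair⟩)

/-! ## The matroid side: ranks, demands and coloops of the three kinds of rank-`4` subsets -/

open Finset ThmH

variable {α : Type*} [DecidableEq α] {M : Matroid α} [M.Finite] {G : Finset α}

/-- The rank-`3` subsets of `τ`. -/
noncomputable def R3 (M : Matroid α) [M.Finite] (τ : Finset α) : Finset (Finset α) :=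
  τ.powerset.filter (fun S : Finset α => M.eRk (S : Set α) = 3)

omit [DecidableEq α] in
/-- Membership in `R3`. -/
theorem mem_R3 {τ S : Finset α} : S ∈ R3 M τ ↔ S ⊆ τ ∧ M.eRk (S : Set α) = 3 := by
  unfold R3
  rw [Finset.mem_filter, Finset.mem_powerset]

/-- `k(S) = #{y ∈ S : r(S ∖ y) ≤ 2}`. -/
noncomputable def kcol (M : Matroid α) [M.Finite] (S : Finset α) : ℕ :=
  (S.filter (fun y => M.eRk ((S.erase y : Finset α) : Set α) ≤ 2)).card

/-- `c(S) = 4/(2 + k) + 2/(1 + k)`. -/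
noncomputable def shareC (M : Matroid α) [M.Finite] (S : Finset α) : ℚ :=
  4 / (2 + (kcol M S : ℚ)) + 2 / (1 + (kcol M S : ℚ))

omit [DecidableEq α] in
/-- A point off the plane `P₀` is outside the closure of every subset of `P₀`. -/
theorem notMem_closure_of_notMem_plane {P₀ : Finset α} (hP₀ : P₀ ∈ planes M) {B : Finset α} (hB : B ⊆ P₀) {x : α}
    (hx : x ∉ P₀) : x ∉ M.closure (B : Set α) := by
  intro h
  have : M.closure (B : Set α) ⊆ (P₀ : Set α) := by
    calc M.closure (B : Set α) ⊆ M.closure (P₀ : Set α) := M.closure_subset_closure (Finset.coe_subset.2 hB)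
      _ = (P₀ : Set α) := (mem_planes.1 hP₀).2.1.closure
  exact hx (Finset.mem_coe.1 (this h))

/-- Adding a point off `P₀` to a subset of `P₀` raises the rank by one. -/
theorem eRk_insert_of_notMem_plane {P₀ : Finset α} (hP₀ : P₀ ∈ planes M) {B : Finset α} (hB : B ⊆ P₀) {x : α}
    (hxE : x ∈ gr M) (hx : x ∉ P₀) : M.eRk ((insert x B : Finset α) : Set α) = M.eRk (B : Set α) + 1 := by
  have hxE' : x ∈ M.E := by rw [← coe_gr]; exact_mod_cast hxE
  rw [Finset.coe_insert]
  exact Matroid.eRk_insert_eq_add_one ⟨hxE', notMem_closure_of_notMem_plane hP₀ hB hx⟩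

/-- A point of `B″ ⊆ P₀` whose removal keeps the rank `3` lies in the closure of the rest. -/
theorem mem_closure_erase_of_eRk_eq_three {P₀ : Finset α} (hP₀ : P₀ ∈ planes M) {B : Finset α} (hB : B ⊆ P₀) {y : α}
    (hy : y ∈ B) (h3 : M.eRk ((B.erase y : Finset α) : Set α) = 3) :
    y ∈ M.closure ((B.erase y : Finset α) : Set α) := by
  rw [closure_eq_of_subset_plane hP₀ ((Finset.erase_subset y B).trans hB) h3]
  exact Finset.mem_coe.2 (hB hy)

/-- The coloops of `B″ ∪ {x}` (`x ∉ P₀`, `B″ ⊆ P₀`) are `x` and the points `y` of `B″` with `r(B″ ∖ y) ≤ 2`. -/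
theorem coloopsOf_insert_subset {P₀ : Finset α} (hP₀ : P₀ ∈ planes M) {B : Finset α} (hB : B ⊆ P₀) {x : α}
    (hx : x ∉ P₀) :
    coloopsOf M (insert x B) ⊆ insert x (B.filter (fun y => M.eRk ((B.erase y : Finset α) : Set α) ≤ 2)) := by
  intro y hy
  rw [mem_coloopsOf] at hy
  obtain ⟨hyB, hycl⟩ := hy
  rw [Finset.mem_insert] at hyB
  rw [Finset.mem_insert, Finset.mem_filter]
  rcases hyB with rfl | hyB
  · exact Or.inl rfl
  · right
    refine ⟨hyB, ?_⟩
    have hyx : y ≠ x := fun h => hx (h ▸ hB hyB)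
    by_contra hgt
    push Not at hgt
    have hle : M.eRk ((B.erase y : Finset α) : Set α) ≤ 3 := by
      rw [← (mem_planes.1 hP₀).2.2]
      exact M.eRk_mono (Finset.coe_subset.2 ((Finset.erase_subset y B).trans hB))
    have h3 : M.eRk ((B.erase y : Finset α) : Set α) = 3 := le_antisymm hle (Order.add_one_le_of_lt hgt)
    apply hycl
    have hsub : B.erase y ⊆ (insert x B).erase y := by
      intro z hz
      rw [Finset.mem_erase] at hz ⊢
      exact ⟨hz.1, Finset.mem_insert_of_mem hz.2⟩
    exact M.closure_subset_closure (Finset.coe_subset.2 hsub) (mem_closure_erase_of_eRk_eq_three hP₀ hB hyB h3)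

/-- `m(B″ ∪ {x}) ≤ 1 + k(B″)`. -/
theorem mTr_insert_le {P₀ : Finset α} (hP₀ : P₀ ∈ planes M) {B : Finset α} (hB : B ⊆ P₀) {x : α} (hx : x ∉ P₀) :
    mTr M (insert x B) ≤ 1 + kcol M B := by
  unfold mTr kcol
  calc (coloopsOf M (insert x B)).card
      ≤ (insert x (B.filter (fun y => M.eRk ((B.erase y : Finset α) : Set α) ≤ 2))).card :=
        Finset.card_le_card (coloopsOf_insert_subset hP₀ hB hx)
    _ ≤ (B.filter (fun y => M.eRk ((B.erase y : Finset α) : Set α) ≤ 2)).card + 1 := Finset.card_insert_le _ _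
    _ = 1 + _ := by ring

/-- `w_∞(B″ ∪ {x}) ≥ 1/(2 + k(B″))`. -/
theorem wInf_insert_ge {P₀ : Finset α} (hP₀ : P₀ ∈ planes M) {B : Finset α} (hB : B ⊆ P₀) {x : α} (hx : x ∉ P₀) :
    1 / (2 + (kcol M B : ℚ)) ≤ wInf M (insert x B) := by
  unfold wInf
  have h := mTr_insert_le hP₀ hB hx
  have h' : (mTr M (insert x B) : ℚ) ≤ 1 + kcol M B := by exact_mod_cast h
  apply one_div_le_one_div_of_le (by positivity)
  linarith

/-- The coloops of `B″ ∪ {a, a′}` (`a ≠ a′ ∉ P₀`, `B″ ⊆ P₀` of rank `3`, inside a rank-`4` set `G`) are among the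
points `y` of `B″` with `r(B″ ∖ y) ≤ 2`. -/
theorem coloopsOf_insert_insert_subset (hG : G ⊆ gr M) (hr : M.eRk (G : Set α) = 4) {P₀ : Finset α}
    (hP₀ : P₀ ∈ planes M) {B : Finset α} (hB : B ⊆ P₀) (hBG : B ⊆ G) (hB3 : M.eRk (B : Set α) = 3) {a a' : α}
    (haG : a ∈ G) (ha'G : a' ∈ G) (ha : a ∉ P₀) (ha' : a' ∉ P₀) (hne : a ≠ a') :
    coloopsOf M (insert a (insert a' B)) ⊆ B.filter (fun y => M.eRk ((B.erase y : Finset α) : Set α) ≤ 2) := by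
  -- a point of `G` off a rank-`4` subset of `G` is in its closure
  have hcl : ∀ {X : Finset α}, X ⊆ G → M.eRk (X : Set α) = 4 → ∀ {z : α}, z ∈ G → z ∈ M.closure (X : Set α) := by
    intro X hXG hX4 z hzG
    by_contra hz
    have hzE : z ∈ M.E := by rw [← coe_gr]; exact_mod_cast hG hzG
    have h := Matroid.eRk_insert_eq_add_one (M := M) (e := z) (X := (X : Set α)) ⟨hzE, hz⟩
    rw [hX4] at h
    have hle : M.eRk ((insert z X : Finset α) : Set α) ≤ 4 := by
      rw [← hr]
      exact M.eRk_mono (Finset.coe_subset.2 (Finset.insert_subset hzG hXG))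
    rw [Finset.coe_insert, h] at hle
    exact absurd hle (by decide)
  intro y hy
  rw [mem_coloopsOf] at hy
  obtain ⟨hyB, hycl⟩ := hy
  rw [Finset.mem_insert, Finset.mem_insert] at hyB
  rw [Finset.mem_filter]
  rcases hyB with rfl | rfl | hyB
  · -- `a` is not a coloop: `B″ ∪ {a′}` has rank `4`
    exfalso
    apply hycl
    have hr4 : M.eRk ((insert a' B : Finset α) : Set α) = 4 := by
      rw [eRk_insert_of_notMem_plane hP₀ hB (hG ha'G) ha', hB3]; rfl
    have hsub : insert a' B ⊆ (insert y (insert a' B)).erase y := by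
      intro z hz
      rw [Finset.mem_erase]
      refine ⟨?_, Finset.mem_insert_of_mem hz⟩
      rintro rfl
      rw [Finset.mem_insert] at hz
      rcases hz with h | h
      · exact hne h
      · exact ha (hB h)
    exact M.closure_subset_closure (Finset.coe_subset.2 hsub)
      (hcl (Finset.insert_subset ha'G hBG) hr4 (by assumption))
  · -- `a′` is not a coloop: `B″ ∪ {a}` has rank `4`
    exfalso
    apply hycl
    have hr4 : M.eRk ((insert a B : Finset α) : Set α) = 4 := by
      rw [eRk_insert_of_notMem_plane hP₀ hB (hG haG) ha, hB3]; rfl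
    have hsub : insert a B ⊆ (insert a (insert y B)).erase y := by
      intro z hz
      rw [Finset.mem_erase, Finset.mem_insert] at *
      rcases hz with rfl | hz
      · exact ⟨hne, Or.inl rfl⟩
      · refine ⟨?_, Or.inr (Finset.mem_insert_of_mem hz)⟩
        rintro rfl
        exact ha' (hB hz)
    exact M.closure_subset_closure (Finset.coe_subset.2 hsub)
      (hcl (Finset.insert_subset haG hBG) hr4 (by assumption))
  · refine ⟨hyB, ?_⟩
    by_contra hgt
    push Not at hgt
    have hle : M.eRk ((B.erase y : Finset α) : Set α) ≤ 3 := by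
      rw [← (mem_planes.1 hP₀).2.2]
      exact M.eRk_mono (Finset.coe_subset.2 ((Finset.erase_subset y B).trans hB))
    have h3 : M.eRk ((B.erase y : Finset α) : Set α) = 3 := le_antisymm hle (Order.add_one_le_of_lt hgt)
    apply hycl
    have hsub : B.erase y ⊆ (insert a (insert a' B)).erase y := by
      intro z hz
      rw [Finset.mem_erase] at hz ⊢
      exact ⟨hz.1, Finset.mem_insert_of_mem (Finset.mem_insert_of_mem hz.2)⟩
    exact M.closure_subset_closure (Finset.coe_subset.2 hsub) (mem_closure_erase_of_eRk_eq_three hP₀ hB hyB h3)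

/-- `w_∞(B″ ∪ {a, a′}) ≥ 1/(1 + k(B″))`. -/
theorem wInf_insert_insert_ge (hG : G ⊆ gr M) (hr : M.eRk (G : Set α) = 4) {P₀ : Finset α}
    (hP₀ : P₀ ∈ planes M) {B : Finset α} (hB : B ⊆ P₀) (hBG : B ⊆ G) (hB3 : M.eRk (B : Set α) = 3) {a a' : α}
    (haG : a ∈ G) (ha'G : a' ∈ G) (ha : a ∉ P₀) (ha' : a' ∉ P₀) (hne : a ≠ a') :
    1 / (1 + (kcol M B : ℚ)) ≤ wInf M (insert a (insert a' B)) := by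
  unfold wInf
  have h : mTr M (insert a (insert a' B)) ≤ kcol M B := by
    unfold mTr kcol
    exact Finset.card_le_card (coloopsOf_insert_insert_subset hG hr hP₀ hB hBG hB3 haG ha'G ha ha' hne)
  have h' : (mTr M (insert a (insert a' B)) : ℚ) ≤ kcol M B := by exact_mod_cast h
  apply one_div_le_one_div_of_le (by positivity)
  linarith

end PercRepro.SixFour
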